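import Summits.Ventures.KdS.RouteWRealAxisHighSpin
import Literature.Geometry.Lorentzian.KerrDeSitterFermionicRealAxis
import HarnessLib

/-!
# Venture KdS — the fermionic real-axis clause at `|s| = 1/2`, fact-free: Casals–Teixeira da
# Costa's Theorem 3.10 with the `|s| = 1/2` escape restricted to the Teukolsky–Starobinsky-coercive
# region (VARIANT B) is a THEOREM of the tree

HONEST FRAMING (venture `Summits/Ventures/KdS`, cell `pub-kds`, seat LIT-1 g30 under lead ruling
A96 (v), "the fact-free CONTROL twin"). Nothing here is a claim about the Final State Conjecture or
about nonlinear stability, and nothing here touches the census records, the window constants or the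
tables. This file assembles LANDED theorems:

* `RouteW.theorem310_bullet1`, `RouteW.realAxis_vanishing_allSpins` (`RouteWRealAxisHighSpin.lean`,
  0 facts): Theorem 3.10's first bullet verbatim and its real-axis bullet under the window clause,
  every `s ∈ ½ℤ`;
* `KerrDeSitter.radial_real_eq_zero_of_fermionicTSCoercive`
  (`Literature/Geometry/Lorentzian/KerrDeSitterFermionicRealAxis.lean`, 0 facts): for `|s| = 1/2`,
  `Im ω = 0`, `Im λ̄ = 0` and `ℭ_{1/2}(λ̄) ≥ 0` (the radial Teukolsky–Starobinsky constant, Wu–Yan's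
  `|C_{1/2}|² = λ_{1/2}`), every generic-boundary radial Teukolsky solution vanishes — the printed
  one-sentence proof of the fermionic clause ("the energy identity implies `u ≡ 0` independently of
  `ω`", [CasalsTeixeiradacosta2022] p. 17; [Costa2019] Prop. 2.21) made exact in its domain of
  validity, with NO window, rotation or `m` condition;

into:

* `RouteW.fermionicRealAxis_coercive_half` — the `|s| = 1/2` COERCIVE part of the residual
  hypothesis `hF` of `RouteW.theorem310_of_fermionicRealAxis`, PROVED (binders in `hF`'s shape, the
  spin clause `2|s| ∈ {1,3}` replaced by `FermionicTSCoercive M a Λ s ω m λ` :=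
  `2|s| = 1 ∧ 0 ≤ Re ℭ_{1/2}(λ̄)`);
* `RouteW.theorem310_tsCoercive` — **Theorem 3.10 (with Definition 3.4's `ω ≠ 0`), generic-boundary
  regime, with the fermionic escape of the real-axis bullet restricted to `|s| = 1/2 ∧ ℭ_{1/2}(λ̄) ≥ 0`
  (VARIANT B: `|s| = 3/2` gets no escape and falls under the window clause) — PROVED, 0 cited facts,
  0 open hypotheses.** Its binder list is LITERALLY that of the Literature fact
  `CasalsTeixeiraDaCosta2022_theorem310` (`KerrDeSitterPartialModeStabilityNonzeroFreq.lean`) with the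
  one change `(∃ k : ℤ, 2 * |s| = k ∧ (k = 1 ∨ k = 3))` ↦ `FermionicTSCoercive M a Λ s ω m lam`;
* `RouteW.theorem310_of_fermionicNoncoercive` — what is left of `CasalsTeixeiraDaCosta2022_theorem310`
  AS PRINTED after this file: only the NON-coercive fermionic clause (`|s| = 1/2` with
  `ℭ_{1/2}(λ̄) < 0`, or `|s| = 3/2`, real `ω ≠ 0`, real `λ̄`, no window condition) implies the fact.
  That clause is asserted nowhere; at `|s| = 1/2`, `ℭ_{1/2}(λ̄) < 0` the printed clause is FALSE:
  the cell's pre-registration P-014, call .3(a), scored HIT (lead ruling A98, REFEREE.md #365, kit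
  record `engine/eng1/halfint/runs/j186658/RECORD.md`): a CERTIFIED real, non-angular generic-boundary
  solution of the `s = 1/2` radial equation, ingoing at `𝓗⁺` and outgoing at `𝓗⁺_c`, at
  `(s, m, M, a, Λ) = (1/2, 1/2, 1, 1/2, 1/50)`, `ω* = 0.015455974714734446` (`ω*/m ∈ (Ω_low, Ω_SR)`),
  `λ̄* = −0.66790170781163645` (`ℭ_{1/2}(λ̄*) = −0.17643 < 0`) — Krawczyk-unique real zero of the
  in→in connection coefficient, winding number `−1` certified on
  `[−231/1250, −21/125] × [1537/100000, 7771/500000]`; a second certified zero at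
  `ω* = 0.0167502993049964`, `λ̄* = −1.8637185665`. The physical statement about MODE solutions
  (angular `λ̄`, for which `ℭ_{1/2} = λ_{1/2} ≥ 0`, [Costa2019] Remark 2.12) is untouched, and no
  displayed theorem of the venture depends on the refuted clause (all displayed `(h1 : …theorem310)`
  consumers are `s ∈ {−2, 0}` and are served fact-free by `RouteW.theorem310_window`).

References: M. Casals, R. Teixeira da Costa, Commun. Math. Phys. 394 (2022) 797–832
[CasalsTeixeiradacosta2022], Theorem 3.10, Definition 3.4, proof Step 1 (p. 17); R. Teixeira da
Costa, Commun. Math. Phys. 378 (2020) 705–781 [Costa2019], Prop. 2.21, Remark 2.12; S.-Q. Wu,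
M.-L. Yan, Phys. Rev. D 69 (2004) 044019 [WuYan2004], Appendix A.
-/

noncomputable section

open Set Complex

namespace Summit.Ventures.KdS

namespace RouteW

open Literature.Geometry.Lorentzian Literature.Geometry.Lorentzian.KerrDeSitter

/-! ### The coercive half of the fermionic residual, proved -/

/-- **The `|s| = 1/2` coercive part of the fermionic residual — PROVED, 0 facts.** The binders of
the hypothesis `hF` of `theorem310_of_fermionicRealAxis` (subextremal, `0 ≤ a`, spin clause,
`ω ≠ 0`, `Im ω = 0`, `Im λ̄ = 0`, the two regime disjunctions, a generic-boundary radial solution) with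
the spin clause `2|s| ∈ {1, 3}` replaced by `FermionicTSCoercive M a Λ s ω m λ`
(`2|s| = 1 ∧ 0 ≤ Re ℭ_{1/2}(λ̄)`) imply `R ≡ 0` on `(r₊, r_c)`. The binders `0 ≤ a`, `ω ≠ 0` and the
regime disjunctions are not used (`radial_real_eq_zero_of_fermionicTSCoercive` needs none of them).
[cite: CasalsTeixeiradacosta2022, Theorem 3.10 (second bullet, |s| = 1/2) with Costa2019 Proposition 2.21] -/
theorem fermionicRealAxis_coercive_half (M a Λ s : ℝ) (ω : ℂ) (m : ℝ) (lam : ℂ)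
    (hsub : IsSubextremal M a Λ) (_ha : 0 ≤ a) (hF : FermionicTSCoercive M a Λ s ω m lam)
    (_hω0 : ω ≠ 0) (hω : ω.im = 0) (hlam : (lambdaBar a Λ s ω m lam).im = 0)
    (_h1 : ω.re ≠ m * horizonAngVel a (rPlus M a Λ) ∨ s ≤ 0)
    (_h2 : ω.re ≠ m * horizonAngVel a (rCosmo M a Λ) ∨ 0 ≤ s)
    (R : ℝ → ℂ) (hR : IsRadialTeukolskySolution M a Λ s ω m lam R)
    (hin : IsIngoingAtEventHorizon M a Λ s ω m R) (hout : IsOutgoingAtCosmoHorizon M a Λ ω m R) :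
    ∀ r ∈ Ioo (rPlus M a Λ) (rCosmo M a Λ), R r = 0 :=
  radial_real_eq_zero_of_fermionicTSCoercive hsub hω hlam hF hR hin hout

/-! ### Theorem 3.10 with the fermionic escape restricted to the coercive region, every spin -/

/-- **CTdC Theorem 3.10 (with Definition 3.4's `ω ≠ 0`), generic-boundary regime, fermionic
real-axis escape restricted to `|s| = 1/2 ∧ ℭ_{1/2}(λ̄) ≥ 0` (VARIANT B) — PROVED for every
`s ∈ ½ℤ`, 0 cited facts, 0 open hypotheses.** Literally the binder list of the Literature fact
`CasalsTeixeiraDaCosta2022_theorem310` with ONE change: in the real-axis disjunct the printed escape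
`(∃ k : ℤ, 2|s| = k ∧ (k = 1 ∨ k = 3))` is replaced by `FermionicTSCoercive M a Λ s ω m lam`.
Bullet 1: `theorem310_bullet1`; real axis with `m = 0` or off the window: `realAxis_vanishing_allSpins`;
real axis, `|s| = 1/2`, coercive `λ̄`: `radial_real_eq_zero_of_fermionicTSCoercive`. The binders
`|a| < 3/Λ`, `a² < 3/Λ`, `m − s ∈ ℤ` and the second regime disjunction are not used.
[cite: CasalsTeixeiradacosta2022, Theorem 3.10 with Definition 3.4; fermionic clause per Costa2019, Proposition 2.21] -/
theorem theorem310_tsCoercive (M a Λ s : ℝ) (ω : ℂ) (m : ℝ) (lam : ℂ) (hsub : IsSubextremal M a Λ)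
    (ha : 0 ≤ a) (_haL : |a| < 3 / Λ) (_haL2 : a ^ 2 < 3 / Λ) (h2s : ∃ k : ℤ, 2 * s = k)
    (_hm : ∃ k : ℤ, m - s = k) (hω0 : ω ≠ 0)
    (hb : (0 < ω.im ∧ (lambdaBar a Λ s ω m lam * (starRingEnd ℂ) ω).im ≤ 0 ∧
        ¬(0 < ‖ω‖ ∧ ‖ω‖ < |m| * superradiantUpper M a Λ)) ∨
      (ω.im = 0 ∧ (lambdaBar a Λ s ω m lam).im = 0 ∧
        (FermionicTSCoercive M a Λ s ω m lam ∨ m = 0 ∨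
          ¬(superradiantLower M a Λ < ω.re / m ∧ ω.re / m < superradiantUpper M a Λ))))
    (h1 : ω.re ≠ m * horizonAngVel a (rPlus M a Λ) ∨ s ≤ 0)
    (_h2 : ω.re ≠ m * horizonAngVel a (rCosmo M a Λ) ∨ 0 ≤ s)
    (R : ℝ → ℂ) (hR : IsRadialTeukolskySolution M a Λ s ω m lam R)
    (hin : IsIngoingAtEventHorizon M a Λ s ω m R) (hout : IsOutgoingAtCosmoHorizon M a Λ ω m R) :
    ∀ r ∈ Ioo (rPlus M a Λ) (rCosmo M a Λ), R r = 0 := by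
  rcases hb with ⟨hωi, hlam, hSR⟩ | ⟨hωi, hlam, hsr⟩
  · exact theorem310_bullet1 hsub ha h2s hωi hlam hSR h1 hR hin hout
  · rcases hsr with hF | hm0 | hwin
    · exact radial_real_eq_zero_of_fermionicTSCoercive hsub hωi hlam hF hR hin hout
    · exact realAxis_vanishing_allSpins hsub ha h2s hωi hω0 hlam (Or.inl hm0) h1 hR hin hout
    · exact realAxis_vanishing_allSpins hsub ha h2s hωi hω0 hlam (Or.inr hwin) h1 hR hin hout

/-! ### What is left of the fact AS PRINTED: only the non-coercive fermionic clause -/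

/-- **The residual of `CasalsTeixeiraDaCosta2022_theorem310_holds` after this file, typed as an
implication (no new fact).** IF the NON-coercive fermionic clause held — `|s| = 1/2` with
`Re ℭ_{1/2}(λ̄) < 0`, or `|s| = 3/2`; `ω ∈ ℝ∖{0}`, `Im λ̄ = 0`, generic regime, no window condition ⟹
`R ≡ 0` — THEN the cited fact `CasalsTeixeiraDaCosta2022_theorem310` would hold outright (the coercive
`|s| = 1/2` part being `fermionicRealAxis_coercive_half`). The hypothesis is asserted nowhere in the
tree; for `|s| = 1/2`, `ℭ_{1/2}(λ̄) < 0` it is contradicted by the cell's certified real-frequency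
solution (pre-registration P-014), which is why the corrected statement `theorem310_tsCoercive` is the
theorem of record. [cite: CasalsTeixeiradacosta2022, Theorem 3.10 (second bullet, |s| = 1/2, 3/2)] -/
theorem theorem310_of_fermionicNoncoercive
    (hN : ∀ (M a Λ s : ℝ) (ω : ℂ) (m : ℝ) (lam : ℂ), IsSubextremal M a Λ → 0 ≤ a →
      ((2 * |s| = 1 ∧ (tsRadialConstantHalf a Λ ω m (lambdaBar a Λ s ω m lam)).re < 0) ∨
        2 * |s| = 3) → ω ≠ 0 → ω.im = 0 →
      (lambdaBar a Λ s ω m lam).im = 0 →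
      (ω.re ≠ m * horizonAngVel a (rPlus M a Λ) ∨ s ≤ 0) →
      (ω.re ≠ m * horizonAngVel a (rCosmo M a Λ) ∨ 0 ≤ s) →
      ∀ R : ℝ → ℂ, IsRadialTeukolskySolution M a Λ s ω m lam R →
        IsIngoingAtEventHorizon M a Λ s ω m R → IsOutgoingAtCosmoHorizon M a Λ ω m R →
          ∀ r ∈ Ioo (rPlus M a Λ) (rCosmo M a Λ), R r = 0) :
    CasalsTeixeiraDaCosta2022_theorem310 := by
  refine theorem310_of_fermionicRealAxis ?_
  intro M a Λ s ω m lam hsub ha hferm hω0 hω hlam h1 h2 R hR hin hout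
  obtain ⟨k, hk, hk13⟩ := hferm
  rcases hk13 with rfl | rfl
  · -- `|s| = 1/2`: coercive or not
    have hk1 : 2 * |s| = 1 := by exact_mod_cast hk
    by_cases hc : 0 ≤ (tsRadialConstantHalf a Λ ω m (lambdaBar a Λ s ω m lam)).re
    · exact fermionicRealAxis_coercive_half M a Λ s ω m lam hsub ha ⟨hk1, hc⟩ hω0 hω hlam h1 h2 R
        hR hin hout
    · exact hN M a Λ s ω m lam hsub ha (Or.inl ⟨hk1, lt_of_not_ge hc⟩) hω0 hω hlam h1 h2 R hR hin
        hout
  · have hk3 : 2 * |s| = 3 := by exact_mod_cast hk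
    exact hN M a Λ s ω m lam hsub ha (Or.inr hk3) hω0 hω hlam h1 h2 R hR hin hout

end RouteW

end Summit.Ventures.KdS

end
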